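import Literature.NumberTheory.EllipticCurves.CasselsTateLocalTerms
import Literature.NumberTheory.EllipticCurves.JZeroTwoPowerTorsionKummer
import HarnessLib

/-!
# Non-vanishing of ONE OF TWO local Cassels–Tate terms when the local Kummer group is a `ℤ[ω]/2^M`-LINE

Topic `NumberTheory/EllipticCurves`; namespace `Literature.NumberTheory.EllipticCurves`. THEOREMS ONLY: **no
definition and no named fact** (D-0026). The RANK-TWO replacement of McCallum 1991 Lemma 5.3 (local half).
McCallum's lemma is PRINTED for `p` odd, non-CM, ±-eigenspaces CYCLIC of order `p^M` («the Tate pairing induces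
… a duality of cyclic groups of order `p^M`»), and the tree proves that cyclic instance generically
(`GenusExact.VisiblePairAtTwo.inv_weilLocalCup_ne_zero_of_orders`: `p^a x ∉ 𝓛`, `p^b y ≠ 0`, `n ≤ a + b + 1`
⇒ `inv(x ∪ y) ≠ 0`). At `p = 2` for a `j = 0` curve at an INERT Kolyvagin prime the local Kummer group
`𝓛 = 𝓛_E^{(m²)}` is not cyclic but a free `ℤ[ω]/2^M`-module of rank one (`E(E)/2^M ≅ E[2^M]`), and the
individual statement fails (one of `x ∪ y`, `x ∪ ωy` may vanish); the right statement is the PAIR form: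

* ★ `inv_weilLocalCup_ne_zero_or_of_line`: if `𝓛` is parametrised by `E[m²]` (`κ : E[m²] →+ H¹`, onto `𝓛`),
  `m² = 2^M`, `fn` on `E[m²]` with `fn² + fn + 1 = 0`, `𝓛^⊥ ⊆ 𝓛` for `inv ∘ ∪` (`hperp`), then for `2^a • x ∉ 𝓛`,
  `y = κ Z`, `y' = κ (fn Z)`, `2^b • y ≠ 0`, `M ≤ a + b + 1`: **`inv(x ∪ y) ≠ 0 ∨ inv(x ∪ y') ≠ 0`**.  Proof: if both
  vanish then `x ∪ κ(ℤZ + ℤ fn Z) = 0`; `ℤZ + ℤ fn Z = E[m²][2^k]` for `2^k` the order of `Z`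
  (`JZero.exists_eq_zsmul_add_zsmul_fn_of_two_pow`, the line structure), so `(2^{M-k} • x) ∪ 𝓛 = 0`, hence
  `2^{M-k} • x ∈ 𝓛` (`hperp`) with `M - k ≤ a` — contradiction.  No cyclicity, no `±`-decomposition, no
  `w`-invariance of the cup product is used; `hperp` (maximal isotropy at the place) and `κ` (the local Kummer
  parametrisation at a Kolyvagin prime) are the caller's.
* `ctLocalTerm_ne_zero_or_of_line`: the same for the local terms `t_E(b₁; β, β')`, `t_E(b₁; β₂, β'₂)` with
  `x = res_E b₁`, `β' = κ Z`, `β'₂ = κ (fn Z)` (`ctLocalTerm_congr_mid` removes `β, β₂ ∈ 𝓛` under isotropy).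

References: [McCallumLMS1991] W. G. McCallum, *Kolyvagin's work on Shafarevich–Tate groups*, LMS LN 153 (1991), §5
Lemma 5.3 and proof of Thm. 5.4 (the cyclic form; p. 305); [MilneADT2006] J. S. Milne, *Arithmetic Duality Theorems*,
2nd ed., I Cor. 2.3, §6 proof of Prop. 6.9; [Rubin1999] K. Rubin, LNM 1716, Cor. 5.5 (the `𝒪/p^M`-line).
-/

noncomputable section

open scoped Classical

universe u

namespace Literature.NumberTheory.EllipticCurves

open _root_.WeierstrassCurve Field
open Literature.NumberTheory.GaloisRepresentations Literature.NumberTheory.GaloisCohomology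
open Literature.NumberTheory.GaloisRepresentations.DiscreteGaloisModule (mu)
open scoped ContRepresentation

section Line

variable {K : Type u} [Field K] [CharZero K] (W : WeierstrassCurve K) [W.IsElliptic] (m : ℕ) [NeZero m]
variable (E : Type u) [Field E] [Algebra K E]
variable (e : geomTorsion W ((m * m : ℕ) : ℤ) → geomTorsion W ((m * m : ℕ) : ℤ) → AlgebraicClosure K)
  (hμ : ∀ S T, e S T ^ (m * m) = 1)
  (hadd₁ : ∀ S₁ S₂ T, e (S₁ + S₂) T = e S₁ T * e S₂ T)
  (hadd₂ : ∀ S T₁ T₂, e S (T₁ + T₂) = e S T₁ * e S T₂)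
  (hgal : ∀ (σ : absoluteGaloisGroup K) (S T : geomTorsion W ((m * m : ℕ) : ℤ)),
    σ • e S T = e (σ • S) (σ • T))

/-- ★ **One of `inv(x ∪ y)`, `inv(x ∪ y')` is non-zero when `𝓛` is a `ℤ[fn]/2^M`-line** (`y = κ Z`, `y' = κ (fn Z)`,
`2^a • x ∉ 𝓛`, `2^b • y ≠ 0`, `M ≤ a + b + 1`, `𝓛^⊥ ⊆ 𝓛`): the rank-two form of McCallum's Lemma 5.3 (local half).
[cite: McCallumLMS1991, §5 Lemma 5.3 and proof of Thm. 5.4] [cite: MilneADT2006, Ch. I, Cor. 2.3] -/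
theorem inv_weilLocalCup_ne_zero_or_of_line {C : Type*} [AddCommGroup C]
    (inv : galoisCohomology (GaloisRep.restrictField E (mu K (m * m))) 2 →+ C)
    (hperp : ∀ x : galoisCohomology (GaloisRep.restrictField E (W.torsionGaloisModule ((m * m : ℕ) : ℤ))) 1,
      (∀ y ∈ W.kummerLocalConditionAt ((m * m : ℕ) : ℤ) E, inv (weilLocalCup W m E e hμ hadd₁ hadd₂ hgal x y) = 0) →
        x ∈ W.kummerLocalConditionAt ((m * m : ℕ) : ℤ) E)
    (κ : geomTorsion W ((m * m : ℕ) : ℤ) →+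
      galoisCohomology (GaloisRep.restrictField E (W.torsionGaloisModule ((m * m : ℕ) : ℤ))) 1)
    (hκs : ∀ y ∈ W.kummerLocalConditionAt ((m * m : ℕ) : ℤ) E, ∃ Z, κ Z = y)
    (fn : geomTorsion W ((m * m : ℕ) : ℤ) →+ geomTorsion W ((m * m : ℕ) : ℤ)) (hrel : ∀ Q, fn (fn Q) + fn Q + Q = 0)
    {M : ℕ} (hmm : m * m = 2 ^ M)
    {x : galoisCohomology (GaloisRep.restrictField E (W.torsionGaloisModule ((m * m : ℕ) : ℤ))) 1}
    {Z : geomTorsion W ((m * m : ℕ) : ℤ)} {a b : ℕ}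
    (hx : ((2 : ℤ) ^ a) • x ∉ W.kummerLocalConditionAt ((m * m : ℕ) : ℤ) E)
    (hyb : ((2 : ℤ) ^ b) • κ Z ≠ 0) (hM : M ≤ a + b + 1) :
    inv (weilLocalCup W m E e hμ hadd₁ hadd₂ hgal x (κ Z)) ≠ 0 ∨
      inv (weilLocalCup W m E e hμ hadd₁ hadd₂ hgal x (κ (fn Z))) ≠ 0 := by
  by_contra h
  push Not at h
  obtain ⟨h1, h2⟩ := h
  have hkill := JZero.two_pow_zsmul_geomTorsion W (m * m) hmm
  -- the exponent `k` of `Z`: `2^k • Z = 0`, `2^(k-1) • Z ≠ 0`, `b + 1 ≤ k ≤ M`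
  have hex : ∃ k : ℕ, ((2 : ℤ) ^ k) • Z = 0 := ⟨M, hkill Z⟩
  set k := Nat.find hex with hk
  have hkZ : ((2 : ℤ) ^ k) • Z = 0 := Nat.find_spec hex
  have hkM : k ≤ M := Nat.find_le (hkill Z)
  have hbk : b + 1 ≤ k := by
    by_contra hlt
    push Not at hlt
    apply hyb
    have h0 : ((2 : ℤ) ^ b) • Z = 0 := by
      rw [show b = (b - k) + k by omega, pow_add, mul_smul, hkZ, smul_zero]
    rw [← map_zsmul, h0, map_zero]
  have hZ' : ((2 : ℤ) ^ (k - 1)) • Z ≠ 0 := Nat.find_min hex (m := k - 1) (by omega)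
  -- `x ∪ κ Z'' = 0` for every `Z''` killed by `2^k` (the line structure: `Z'' = c Z + d fn Z`)
  have hvan : ∀ Z'' : geomTorsion W ((m * m : ℕ) : ℤ), ((2 : ℤ) ^ k) • Z'' = 0 →
      inv (weilLocalCup W m E e hμ hadd₁ hadd₂ hgal x (κ Z'')) = 0 := by
    intro Z'' hZ''
    obtain ⟨c, d, hcd⟩ := JZero.exists_eq_zsmul_add_zsmul_fn_of_two_pow W (m * m) fn hmm hrel hkM hkZ hZ' hZ''
    rw [hcd, map_add, map_zsmul, map_zsmul, map_add, map_zsmul, map_zsmul, map_add, map_zsmul, map_zsmul, h1, h2,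
      smul_zero, smul_zero, add_zero]
  -- hence `(2^(M-k) • x) ∪ 𝓛 = 0`, so `2^(M-k) • x ∈ 𝓛`
  have hmem : ((2 : ℤ) ^ (M - k)) • x ∈ W.kummerLocalConditionAt ((m * m : ℕ) : ℤ) E := by
    refine hperp _ fun y'' hy'' ↦ ?_
    obtain ⟨Z'', rfl⟩ := hκs y'' hy''
    have h2k : ((2 : ℤ) ^ k) • (((2 : ℤ) ^ (M - k)) • Z'') = 0 := by
      rw [smul_smul, ← pow_add, Nat.add_sub_cancel' hkM]; exact hkill Z''
    have h0 := hvan _ h2k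
    rw [map_zsmul, map_zsmul] at h0
    rw [map_zsmul (weilLocalCup W m E e hμ hadd₁ hadd₂ hgal), AddMonoidHom.coe_smul, Pi.smul_apply]
    exact h0
  -- contradiction with `2^a • x ∉ 𝓛` (`M - k ≤ a`)
  apply hx
  rw [show a = (a - (M - k)) + (M - k) by omega, pow_add, mul_smul]
  exact AddSubgroup.zsmul_mem _ hmem _

/-- **The pair form for the local terms `t_E(b₁; β, β')`**: with `x = res_E b₁`, `β' = κ Z`, `β'₂ = κ (fn Z)` and any
`β, β₂ ∈ 𝓛` (removed by `ctLocalTerm_congr_mid` under the isotropy of `𝓛`), one of `t_E(b₁; β, κ Z)`,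
`t_E(b₁; β₂, κ (fn Z))` is non-zero. [cite: McCallumLMS1991, §5 Lemma 5.3 and proof of Thm. 5.4]
[cite: MilneADT2006, Ch. I §6, proof of Prop. 6.9] -/
theorem ctLocalTerm_ne_zero_or_of_line
    (invE : galoisCohomology (GaloisRep.restrictField E (mu K (m * m))) 2 →+ ZMod (m * m))
    (hiso : ∀ ⦃x y : galoisCohomology (GaloisRep.restrictField E (W.torsionGaloisModule ((m * m : ℕ) : ℤ))) 1⦄,
      x ∈ W.kummerLocalConditionAt ((m * m : ℕ) : ℤ) E → y ∈ W.kummerLocalConditionAt ((m * m : ℕ) : ℤ) E →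
        weilLocalCup W m E e hμ hadd₁ hadd₂ hgal x y = 0)
    (hperp : ∀ x : galoisCohomology (GaloisRep.restrictField E (W.torsionGaloisModule ((m * m : ℕ) : ℤ))) 1,
      (∀ y ∈ W.kummerLocalConditionAt ((m * m : ℕ) : ℤ) E, invE (weilLocalCup W m E e hμ hadd₁ hadd₂ hgal x y) = 0) →
        x ∈ W.kummerLocalConditionAt ((m * m : ℕ) : ℤ) E)
    (κ : geomTorsion W ((m * m : ℕ) : ℤ) →+
      galoisCohomology (GaloisRep.restrictField E (W.torsionGaloisModule ((m * m : ℕ) : ℤ))) 1)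
    (hκ : ∀ Z, κ Z ∈ W.kummerLocalConditionAt ((m * m : ℕ) : ℤ) E)
    (hκs : ∀ y ∈ W.kummerLocalConditionAt ((m * m : ℕ) : ℤ) E, ∃ Z, κ Z = y)
    (fn : geomTorsion W ((m * m : ℕ) : ℤ) →+ geomTorsion W ((m * m : ℕ) : ℤ)) (hrel : ∀ Q, fn (fn Q) + fn Q + Q = 0)
    {M : ℕ} (hmm : m * m = 2 ^ M) (b₁ : galoisCohomology (W.torsionGaloisModule ((m * m : ℕ) : ℤ)) 1)
    {β β₂ : galoisCohomology (GaloisRep.restrictField E (W.torsionGaloisModule ((m * m : ℕ) : ℤ))) 1}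
    (hβ : β ∈ W.kummerLocalConditionAt ((m * m : ℕ) : ℤ) E) (hβ₂ : β₂ ∈ W.kummerLocalConditionAt ((m * m : ℕ) : ℤ) E)
    {Z : geomTorsion W ((m * m : ℕ) : ℤ)} {a b : ℕ}
    (hx : ((2 : ℤ) ^ a) • galoisCohomology.res (W.torsionGaloisModule ((m * m : ℕ) : ℤ)) E 1 b₁ ∉
      W.kummerLocalConditionAt ((m * m : ℕ) : ℤ) E)
    (hyb : ((2 : ℤ) ^ b) • κ Z ≠ 0) (hM : M ≤ a + b + 1) :
    ctLocalTerm W m E e hμ hadd₁ hadd₂ hgal invE b₁ β (κ Z) ≠ 0 ∨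
      ctLocalTerm W m E e hμ hadd₁ hadd₂ hgal invE b₁ β₂ (κ (fn Z)) ≠ 0 := by
  rw [ctLocalTerm_congr_mid (invE := invE) hiso b₁ hβ (zero_mem _) (hκ Z),
    ctLocalTerm_congr_mid (invE := invE) hiso b₁ hβ₂ (zero_mem _) (hκ (fn Z)), ctLocalTerm, ctLocalTerm, sub_zero]
  exact inv_weilLocalCup_ne_zero_or_of_line W m E e hμ hadd₁ hadd₂ hgal invE hperp κ hκs fn hrel hmm hx hyb hM

end Line

end Literature.NumberTheory.EllipticCurves

end
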